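import Summits.Ventures.PercRepro.Conditioning

/-!
# The two conditional laws as sums over the other edges

For an edge `e`, the conditional laws `P_{p[e:=1]}` and `P_{p[e:=0]}` (edge `e` surely open /
surely closed) are written as a single sum over all configurations weighted by `p[e := 0]`, each
configuration seen with `e` opened resp. closed:

* `sum_weight_update_one`: `Σ_ω w_{p[e:=1]}(ω) F(ω) = Σ_η w_{p[e:=0]}(η) F(η[e:=1])`,
* `sum_weight_update_zero`: `Σ_ω w_{p[e:=0]}(ω) F(ω) = Σ_η w_{p[e:=0]}(η) F(η[e:=0])`,
* `prob_update_one_eq_sum`, `prob_update_zero_eq_sum`, `prob_update_sub_eq_sum`: the same for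
  probabilities, and for the slope `P_{p[e:=1]}(A) - P_{p[e:=0]}(A)` of `P_p(A)` in `p e`.

This turns a one-edge conditioning step into a pointwise statement about the effect of opening one
edge — the engine of `Summits.Ventures.PercRepro.PairSum` and `Summits.Ventures.PercRepro.SMCPrinciple`.
-/

namespace PercRepro

open Finset

section ConditionalSums

variable {E : Type*} [Fintype E] [DecidableEq E]

/-- `weightErase p e` does not depend on the state of `e`. -/
theorem weightErase_update_config (p : E → ℝ) (e : E) (ω : Config E) (b : Bool) :
    weightErase p e (Function.update ω e b) = weightErase p e ω := by
  unfold weightErase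
  refine Finset.prod_congr rfl fun e' he' => ?_
  rw [Function.update_of_ne (Finset.mem_erase.1 he').1]

/-- `Σ_ω w_{p[e:=0]}(ω) F(ω) = Σ_η w_{p[e:=0]}(η) F(η[e:=0])`: under `p[e := 0]` only configurations
with `e` closed carry weight. -/
theorem sum_weight_update_zero (p : E → ℝ) (e : E) (F : Config E → ℝ) :
    ∑ ω, weight (Function.update p e 0) ω * F ω =
      ∑ η, weight (Function.update p e 0) η * F (Function.update η e false) := by
  refine Finset.sum_congr rfl fun η _ => ?_
  cases h : η e
  · have h' : Function.update η e false = η := by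
      rw [← h]
      exact Function.update_eq_self e η
    rw [h']
  · simp [weight_update_zero, h]

/-- `Σ_ω w_{p[e:=1]}(ω) F(ω) = Σ_η w_{p[e:=0]}(η) F(η[e:=1])`: reindexing by the flip of `e`. -/
theorem sum_weight_update_one (p : E → ℝ) (e : E) (F : Config E → ℝ) :
    ∑ ω, weight (Function.update p e 1) ω * F ω =
      ∑ η, weight (Function.update p e 0) η * F (Function.update η e true) := by
  rw [← (flipEdge_involutive e).bijective.sum_comp]
  refine Finset.sum_congr rfl fun η _ => ?_
  cases h : η e
  · have h1 : flipEdge e η = Function.update η e true := by simp [flipEdge, h]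
    rw [h1]
    have h2 : weight (Function.update p e 1) (Function.update η e true) = weightErase p e η := by
      simp [weight_update_one, weightErase_update_config]
    have h3 : weight (Function.update p e 0) η = weightErase p e η := by
      rw [weight_update_zero, h]
      simp
    rw [h2, h3]
  · have h1 : flipEdge e η = Function.update η e false := by simp [flipEdge, h]
    rw [h1]
    have h2 : weight (Function.update p e 1) (Function.update η e false) = 0 := by
      rw [weight_update_one]
      simp
    have h3 : weight (Function.update p e 0) η = 0 := by
      rw [weight_update_zero, h]
      simp
    rw [h2, h3]
    simp

/-- `P_{p[e:=0]}(A)` as a sum over all configurations weighted by `p[e:=0]`, each configuration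
seen with `e` closed. -/
theorem prob_update_zero_eq_sum (p : E → ℝ) (e : E) (A : Set (Config E)) :
    prob (Function.update p e 0) A =
      ∑ η, weight (Function.update p e 0) η * A.indicator 1 (Function.update η e false) := by
  rw [← sum_weight_update_zero]
  unfold prob
  refine Finset.sum_congr rfl fun ω _ => ?_
  by_cases hA : ω ∈ A <;> simp [hA]

/-- `P_{p[e:=1]}(A)` as a sum over all configurations weighted by `p[e:=0]`, each configuration
seen with `e` opened. -/
theorem prob_update_one_eq_sum (p : E → ℝ) (e : E) (A : Set (Config E)) :
    prob (Function.update p e 1) A =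
      ∑ η, weight (Function.update p e 0) η * A.indicator 1 (Function.update η e true) := by
  rw [← sum_weight_update_one]
  unfold prob
  refine Finset.sum_congr rfl fun ω _ => ?_
  by_cases hA : ω ∈ A <;> simp [hA]

/-- The slope of `P_p(A)` in the edge probability `p e`, as a sum over the other edges. -/
theorem prob_update_sub_eq_sum (p : E → ℝ) (e : E) (A : Set (Config E)) :
    prob (Function.update p e 1) A - prob (Function.update p e 0) A =
      ∑ η, weight (Function.update p e 0) η *
        (A.indicator 1 (Function.update η e true) - A.indicator 1 (Function.update η e false)) := by
  rw [prob_update_one_eq_sum, prob_update_zero_eq_sum, ← Finset.sum_sub_distrib]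
  simp only [mul_sub]

end ConditionalSums

end PercRepro
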